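import Summits.QuantumFields.YangMills.Theorems.BalabanUVNodesN22KnitTwoConstants
import Summits.QuantumFields.YangMills.Theorems.BalabanUVNodesSpineRates

/-!
# BalabanUVNodes ∕ N22 knit, ROAD 3 AT THE VERTEX — fading memory from the tower rate `θ` and analyticity on POWER-WEIGHTED RELATIVE discs
# (radius `c·t` about the coupling `t`, bounds `M·μ^{age}·t^{p}·e^{−κd}`: the shape [Balaban1987RG1] (2.9) supports near `g → 0⁺`, pv10's
# `T4CouplingAnalyticity.CouplingAnalyticRelW` with weight `t^{p}`): **NE9 ∧ FadingMemory at the rate `θ^{1−1∕p}·μ^{1∕p}`** — the graded law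
# between pv10's linear weight `p = 1` (bounded moduli, no fading: `ne9_of_couplingAnalyticRelLin`) and the uniform margins of
# `BalabanUVNodesN22KnitTwoConstants` (`p = ∞`, every rate above `θ`) (Track A, DAG node N22 = NE9; cluster K4 «SpineRates»; seat `pub-ymgap-dag-n22-a`)

HONEST FRAMING.  Count-neutral kernel bookkeeping over hypothesis shapes on the ABSTRACT carriers `T4OutputRate.Carriers`; NOT a node discharge;
NE5 ∕ NE9 NOT IN PRINT, NOT PROVED; instance on Bałaban's localized `E^{(j)}(X)` 0∕1 (W1); one finite four-torus programme at fixed ε; nothing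
continuum ∕ ℝ⁴ ∕ OS ∕ mass-gap ∕ Clay.  0 `sorry`, 0 `def`, standard axioms.  `--supports` item `SpineGivenEndpoint` (route «BalabanUVNodes»).

WHY.  ROAD 3 (`…N22KnitTwoConstants.ne9_and_fadingMemory_of_osc_analytic_rpow`) asks analyticity of each young-coupling section on discs of a
UNIFORM radius `r` about every point of `]0, γ]` — near the vertex `g → 0⁺` this is the p. 266 alternative cut-off's type, not (2.9)'s: pv10's
standing verdict (`T4CouplingAnalyticity` §10, `exists_couplingAnalyticRel_not_ne9Window`) is that (2.9) gives only RELATIVE radii `c·t`, and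
that unweighted relative radii do NOT yield NE9 on the window, while LINEARLY weighted ones (bounds `∝ t`) yield NE9 with BOUNDED,
non-fading moduli (§9, `ne9_of_couplingAnalyticRelLin`).  THIS FILE puts the tower rate (O) into that picture: with bounds vanishing to order `p`
at the vertex, the one-sided two-constants bound at `t` with radius `∝ t` and exponent `s = 1∕p` has the singular factor `t^{−1}` EXACTLY
cancelled by `(t^{p})^{1∕p}` — so the sections are Lipschitz on `]0, γ]` with constants `∝ (θ^{1−1∕p}μ^{1∕p})^{age}`:
* `abs_sub_le_of_deriv_bound` (mean value for a real section with an analytic extension); `deriv_bound_vertex` — at a point `t ∈ ]0, γ]`: analytic on `D̄(t, ct)` with `‖F‖ ≤ B_t = M·μ^{a}·t^{p}·w`, one-sided flat `ε = C₀θ^{a}w`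
  towards the interior ⟹ `‖F′(t)‖ ≤ (32p²∕c′)·C₀^{1−1∕p}(2M)^{1∕p}·(θ^{1−1∕p}μ^{1∕p})^{a}·w`, `c′ = min(c,1)∕2` — two regimes: `ε ≤ 2B_t`
  (three lines, `N22KnitTwoConstants.norm_deriv_le_twoConstants_oneSided` with `s = 1∕p`, `r = c′t`) and `2B_t < ε` (plain Cauchy on the
  circle of radius `ct`; `B_t∕(ct) ≤ ε^{1−1∕p}(2B_t)^{1∕p}∕(2ct)`).
* **`coordLipschitzOn_of_osc_analyticRelPow`** ∕ **`ne9_and_fadingMemory_of_osc_analyticRelPow`** — (P) + (O) (`C₀ > 0`, rate `θ > 0`) +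
  (A_p) power-weighted relative-disc analyticity (`c > 0`, `p ≥ 2`, bounds `M·μ^{age−1}·t^{p}·e^{−κd}`, `θ ≤ μ`, `C₀ ≤ 2Mγ^{p}`-free: no
  comparison of `ε` with `B_t` is assumed — both regimes are handled) ⟹ **`NE9 E (Window γ) κ Λ ∧ FadingMemory C₉ τ_p Λ`**,
  `τ_p = θ^{1−1∕p}μ^{1∕p}`, `Λ k i = C₉·τ_p^{k−i}`, `C₉ = (32p²∕c′)·C₀^{1−1∕p}(2M)^{1∕p}∕τ_p`.  READING: fading iff `θ^{p−1}μ < 1`; `p = 2`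
  reproduces ROAD 2's C^{1,1} condition `θμ < 1` at the vertex-compatible shape; `p → ∞` recovers every rate above `θ`; `p = 1` (pv10's
  shape of record) gives the rate `μ` — no fading, consistent with §9∕§10 there.  So on ROAD 3 the vertex costs exactly the ORDER OF
  VANISHING of the analytic bounds at `g = 0`, a located question about [Balaban1987RG1] (2.13) at small coupling (p. 268: *«the expression
  under the exponential above vanishes at g_k = 0»*), not a smallness condition.
* §3 AT THE RECORD (plan word (W2)): `n22At_of_oscAnalyticRelPow`, **`s_N22_of_oscAnalyticRelPow`** — the vertex slot's closers for the K4 stub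
  `S_N22 RRec` (companions of `YMDAG.N22.n22At_of_oscAnalytic` ∕ `s_N22_of_oscAnalytic` in `BalabanUVNodesN22AtRecordAnalytic`).
* §4 `ne9_and_fadingMemory_of_vertexQuotient` — the third vertex option of the census: a DIFFERENCE-QUOTIENT letter from the vertex,
  `‖F(z) − e₀‖ ≤ K·θ^{age}·‖z‖·e^{−κd}` on the relative discs (UV-insensitivity of `∂_{g_i}E` at `g_i = 0`; fading stated at the derivative level
  = W1's content at the vertex) ⟹ NE9 ∧ FadingMemory at the rate `θ` by Cauchy alone.  HONEST VERTEX VERDICT: under (2.9) with only LINEAR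
  vanishing (`p = 1`) neither (O) + C^{1,1} nor (O) + analyticity yields fading near `t ≲ (θ∕μ)^{age}`; one of §2 (`p ≥ 2`, `θ^{p−1}μ < 1`),
  uniform margins (`N22KnitTwoConstants`), or §4's letter is needed — the located form of pv10's (W1)∕(L2) for node N22.

References (TYPES only): [Balaban1987RG1] = T. Bałaban, Commun. Math. Phys. **109** (1987) 249–301 — p. 256, Thm 1 p. 259, (1.18) and the C^∞ ∕
analytic clause p. 263, (2.9) p. 266, (2.13) p. 268, p. 298; [Balaban1988RG2Cluster] (1.34) p. 9 (the relative small-field domain).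
-/

noncomputable section

namespace Summit.QuantumFields.YangMills.BalabanUVNodes.N22KnitVertex

open Set Metric Complex Real Filter
open scoped Real Topology
open Summit.QuantumFields.YangMills.BalabanUVNodes.N22KnitTwoConstants (norm_deriv_le_twoConstants_oneSided interp_geometric)

/-! ## §1 The derivative bound at a point of the window, relative radius, two regimes -/

/-- **THE VERTEX DERIVATIVE BOUND.**  `F` complex-differentiable on a set containing the closed disc `D̄(t, ct)` (`t > 0`, `c > 0`), with
`‖F‖ ≤ B` there, `B = M·μ^{a}·t^{p}·w` (`p ≥ 2`), and ONE-SIDED flat: `|F(t + σu) − F(t)| ≤ ε = C₀·θ^{a}·w` for `u ∈ [0, c′t]`, `c′ = min(c,1)∕2`,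
`σ = ±1`.  Then `‖F′(t)‖ ≤ (32p²∕c′)·C₀^{1−1∕p}·(2M)^{1∕p}·(θ^{1−1∕p}μ^{1∕p})^{a}·w` — the factor `t^{−1}` of the radius is cancelled by
`(t^{p})^{1∕p}`; the regime `2B < ε` is plain Cauchy. [folklore] -/
theorem deriv_bound_vertex {F : ℂ → ℂ} {D : Set ℂ} {t c C₀ θ M μ w σ : ℝ} {p a : ℕ} (hσ : σ = 1 ∨ σ = -1)
    (ht : 0 < t) (hc : 0 < c) (hp : 2 ≤ p) (hC₀ : 0 < C₀) (hθ : 0 < θ) (hM : 0 < M) (hμ : 0 < μ) (hw : 0 < w)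
    (hF : DifferentiableOn ℂ F D) (hD : closedBall (t : ℂ) (c * t) ⊆ D)
    (hB : ∀ z ∈ closedBall (t : ℂ) (c * t), ‖F z‖ ≤ M * μ ^ a * t ^ p * w)
    (hflat : ∀ u : ℝ, 0 ≤ u → u ≤ min c 1 / 2 * t → ‖F ((t + σ * u : ℝ) : ℂ) - F t‖ ≤ C₀ * θ ^ a * w) :
    ‖deriv F t‖ ≤ 32 * (p : ℝ) ^ 2 / (min c 1 / 2) * (C₀ ^ (1 - (p : ℝ)⁻¹) * (2 * M) ^ (p : ℝ)⁻¹)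
      * (θ ^ (1 - (p : ℝ)⁻¹) * μ ^ (p : ℝ)⁻¹) ^ a * w := by
  set s : ℝ := (p : ℝ)⁻¹ with hs
  set c' : ℝ := min c 1 / 2 with hc'
  set ε : ℝ := C₀ * θ ^ a * w with hε
  set B : ℝ := M * μ ^ a * t ^ p * w with hBdef
  have hp0 : (0 : ℝ) < p := by exact_mod_cast (by omega : 0 < p)
  have hp2 : (2 : ℝ) ≤ p := by exact_mod_cast hp
  have hs0 : 0 < s := inv_pos.mpr hp0
  have hs1 : s < 1 := by rw [hs]; exact inv_lt_one_of_one_lt₀ (by linarith)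
  have hc'0 : 0 < c' := by rw [hc']; positivity
  have hc'c : c' < c := by
    have := min_le_left c 1; rw [hc']; linarith
  have hc'1 : c' ≤ 1 / 2 := by have := min_le_right c 1; rw [hc']; linarith
  have hε0 : 0 < ε := by positivity
  have hB0 : 0 < B := by positivity
  have htp : 0 < t ^ p := pow_pos ht p
  -- the common right-hand side and the interpolation identity
  have hinterp : ε ^ (1 - s) * (2 * B) ^ s = C₀ ^ (1 - s) * (2 * M) ^ s * (θ ^ (1 - s) * μ ^ s) ^ a * w * t := by
    have e1 : 2 * B = (2 * M * μ ^ a * w) * t ^ p := by rw [hBdef]; ring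
    have e2 : (t ^ p) ^ s = t := by
      rw [hs]; exact Real.pow_rpow_inv_natCast ht.le (by omega)
    rw [e1, Real.mul_rpow (by positivity) htp.le, e2, ← mul_assoc, interp_geometric hC₀ hM hθ hμ hw a]
  have hK : 0 ≤ C₀ ^ (1 - s) * (2 * M) ^ s * (θ ^ (1 - s) * μ ^ s) ^ a * w := by
    have : 0 ≤ C₀ ^ (1 - s) := Real.rpow_nonneg hC₀.le _
    have : 0 ≤ (2 * M) ^ s := Real.rpow_nonneg (by linarith) _
    have : 0 ≤ (θ ^ (1 - s) * μ ^ s) ^ a := pow_nonneg (mul_nonneg (Real.rpow_nonneg hθ.le _) (Real.rpow_nonneg hμ.le _)) a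
    positivity
  have hball : ball (t : ℂ) (c * t) ⊆ D := ball_subset_closedBall.trans hD
  have hFt : DifferentiableOn ℂ F (ball (t : ℂ) (c * t)) := hF.mono hball
  by_cases hreg : ε ≤ 2 * B
  · -- regime 1: three lines with `s = 1/p`, flat radius `c′t < ct`
    have hBt : ∀ z ∈ ball (t : ℂ) (c * t), ‖F z‖ ≤ B := fun z hz => hB z (ball_subset_closedBall hz)
    have hr : 0 < c' * t := mul_pos hc'0 ht
    have hrR : c' * t < c * t := mul_lt_mul_of_pos_right hc'c ht
    have h := norm_deriv_le_twoConstants_oneSided hσ hr hrR hs0 hs1 hε0 hreg hFt hBt (fun u hu0 hur => hflat u hu0 hur)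
    calc ‖deriv F t‖ ≤ 32 / (s ^ 2 * (c' * t)) * ε ^ (1 - s) * (2 * B) ^ s := h
      _ = 32 / (s ^ 2 * (c' * t)) * (C₀ ^ (1 - s) * (2 * M) ^ s * (θ ^ (1 - s) * μ ^ s) ^ a * w * t) := by
          rw [mul_assoc (32 / (s ^ 2 * (c' * t))), hinterp]
      _ = 32 * (p : ℝ) ^ 2 / c' * (C₀ ^ (1 - s) * (2 * M) ^ s) * (θ ^ (1 - s) * μ ^ s) ^ a * w := by
          rw [hs]; field_simp
  · -- regime 2: plain Cauchy on the circle of radius `ct`, then `B ≤ ε^{1−s}(2B)^{s}/2`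
    have hreg' : 2 * B < ε := lt_of_not_ge hreg
    have hcR : 0 < c * t := mul_pos hc ht
    have hC := Complex.norm_deriv_le_of_forall_mem_sphere_norm_le hcR (hF.diffContOnCl_ball hD)
      (fun z hz => hB z (sphere_subset_closedBall hz))
    have hBle : B ≤ ε ^ (1 - s) * (2 * B) ^ s / 2 := by
      -- `2B = (2B)^{s}·(2B)^{1−s} ≤ (2B)^{s}·ε^{1−s}`
      have h2B : 0 < 2 * B := by linarith
      have e : (2 * B) ^ s * (2 * B) ^ (1 - s) = 2 * B := by
        rw [← Real.rpow_add h2B, add_sub_cancel, Real.rpow_one]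
      have hmono : (2 * B) ^ (1 - s) ≤ ε ^ (1 - s) := Real.rpow_le_rpow h2B.le hreg'.le (by linarith)
      have h3 : (2 * B) ^ s * (2 * B) ^ (1 - s) ≤ (2 * B) ^ s * ε ^ (1 - s) :=
        mul_le_mul_of_nonneg_left hmono (Real.rpow_nonneg h2B.le _)
      rw [e, mul_comm ((2 * B) ^ s) (ε ^ (1 - s))] at h3
      linarith
    calc ‖deriv F t‖ ≤ B / (c * t) := by simpa [hBdef] using hC
      _ ≤ (ε ^ (1 - s) * (2 * B) ^ s / 2) / (c * t) := div_le_div_of_nonneg_right hBle hcR.le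
      _ = (C₀ ^ (1 - s) * (2 * M) ^ s * (θ ^ (1 - s) * μ ^ s) ^ a * w) * (1 / (2 * c)) := by
          rw [hinterp]; field_simp
      _ ≤ (C₀ ^ (1 - s) * (2 * M) ^ s * (θ ^ (1 - s) * μ ^ s) ^ a * w) * (32 * (p : ℝ) ^ 2 / c') := by
          refine mul_le_mul_of_nonneg_left ?_ hK
          -- `1/(2c) ≤ 32p²/c′` since `c′ < c` and `p ≥ 2`
          rw [div_le_div_iff₀ (by positivity) hc'0]
          have hp4 : (4 : ℝ) ≤ (p : ℝ) ^ 2 := by nlinarith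
          calc 1 * c' = c' := one_mul _
            _ ≤ c := hc'c.le
            _ ≤ 32 * (p : ℝ) ^ 2 * (2 * c) := by nlinarith
      _ = 32 * (p : ℝ) ^ 2 / c' * (C₀ ^ (1 - s) * (2 * M) ^ s) * (θ ^ (1 - s) * μ ^ s) ^ a * w := by ring


/-- **MEAN VALUE FOR A REAL SECTION WITH AN ANALYTIC EXTENSION**: if `F` is complex-differentiable on `D`, `D` is a neighbourhood of every point of
`]0, γ]`, `F = f` on `]0, γ]` and `‖F′‖ ≤ L` there, then `|f s₁ − f s₂| ≤ L·|s₁ − s₂|` on `]0, γ]`. [folklore] -/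
theorem abs_sub_le_of_deriv_bound {F : ℂ → ℂ} {D : Set ℂ} {f : ℝ → ℝ} {γ L : ℝ} (hF : DifferentiableOn ℂ F D)
    (hD : ∀ t ∈ Ioc (0 : ℝ) γ, D ∈ 𝓝 (t : ℂ)) (hf : ∀ t ∈ Ioc (0 : ℝ) γ, F t = (f t : ℂ))
    (hL : ∀ t ∈ Ioc (0 : ℝ) γ, ‖deriv F t‖ ≤ L) {s₁ s₂ : ℝ} (hs₁ : s₁ ∈ Ioc (0 : ℝ) γ) (hs₂ : s₂ ∈ Ioc (0 : ℝ) γ) :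
    |f s₁ - f s₂| ≤ L * |s₁ - s₂| := by
  have hfd : ∀ t ∈ Ioc (0 : ℝ) γ, HasDerivWithinAt f ((deriv F t).re) (Ioc (0 : ℝ) γ) t := by
    intro t ht
    have h1 : HasDerivAt F (deriv F t) (t : ℂ) := (hF.differentiableAt (hD t ht)).hasDerivAt
    have h2 : HasDerivAt (fun x : ℝ => (F x).re) (deriv F t).re t := h1.real_of_complex
    refine h2.hasDerivWithinAt.congr (fun x hx => ?_) ?_
    · rw [hf x hx, Complex.ofReal_re]
    · rw [hf t ht, Complex.ofReal_re]
  have hmv : ∀ x y : ℝ, x ∈ Ioc (0 : ℝ) γ → y ∈ Ioc (0 : ℝ) γ → x ≤ y → |f y - f x| ≤ L * (y - x) := by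
    intro x y hx hy hxy
    have hsub : Icc x y ⊆ Ioc (0 : ℝ) γ := fun z hz => ⟨hx.1.trans_le hz.1, hz.2.trans hy.2⟩
    have h := norm_image_sub_le_of_norm_deriv_le_segment' (f := f) (f' := fun t => (deriv F t).re)
      (fun z hz => (hfd z (hsub hz)).mono hsub)
      (fun z hz => ((Complex.abs_re_le_norm _).trans (hL z (hsub (Ico_subset_Icc_self hz))))) y (right_mem_Icc.mpr hxy)
    rw [Real.norm_eq_abs] at h
    exact h
  rcases le_total s₁ s₂ with h | h
  · rw [abs_sub_comm (f s₁) (f s₂), abs_sub_comm s₁ s₂, abs_of_nonneg (sub_nonneg.mpr h)]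
    exact hmv s₁ s₂ hs₁ hs₂ h
  · rw [abs_of_nonneg (sub_nonneg.mpr h)]
    exact hmv s₂ s₁ hs₂ hs₁ h

/-! ## §2 On the abstract carriers: node N22 from (P) + (O) + power-weighted relative-disc analyticity -/

section Abstract

open Literature.MathematicalPhysics.QuantumFieldTheory.Balaban1983to89
open Literature.MathematicalPhysics.QuantumFieldTheory.Balaban1983to89.T4OutputRate
open Literature.MathematicalPhysics.QuantumFieldTheory.Balaban1983to89.T4CouplingAnalyticity
  (CoordLipschitzOn update_mem_boxWindow ne9_of_coordLipschitz)
open Summit.QuantumFields.YangMills.BalabanUVNodes.N22Knit (fadingMemory_geometric)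

variable {C : Carriers} {Bg : Type} {E : Functional C Bg}

/-- **(O) + POWER-WEIGHTED RELATIVE-DISC ANALYTICITY ⇒ COORDINATEWISE FADING LIPSCHITZ MODULI AT THE RATE `θ^{1−1∕p}μ^{1∕p}`.**  (O) with
`C₀ > 0`, `θ > 0`; (A_p): every young-coupling section extends to a complex-analytic `F` on a set containing the closed discs `D̄(t, ct)`, `t ∈ ]0, γ]`,
with `‖F‖ ≤ M·μ^{scale X − 1 − i}·t^{p}·e^{−κd(X)}` on `D̄(t, ct)` (`c > 0`, `p ≥ 2`, `θ ≤ μ`).  Then `CoordLipschitzOn ]0, γ] E κ Λ` with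
`Λ k i = C₉·τ^{k−i}`, `τ = θ^{1−1∕p}μ^{1∕p}`, `C₉ = (32p²∕c′)·C₀^{1−1∕p}(2M)^{1∕p}∕τ`, `c′ = min(c,1)∕2`. [folklore] -/
theorem coordLipschitzOn_of_osc_analyticRelPow {γ κ C₀ θ M μ c : ℝ} {p : ℕ}
    (hO : ∀ g ∈ Window γ, ∀ g' ∈ Window γ, ∀ (U : Bg) (X : C.Dom) (a : ℕ), a ≤ C.scale X →
      (∀ n, a ≤ n → g n = g' n) → |E g U X - E g' U X| ≤ C₀ * θ ^ (C.scale X - a) * Real.exp (-(κ * C.d X)))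
    (hA : ∀ g ∈ Window γ, ∀ (U : Bg) (X : C.Dom) (i : ℕ), i < C.scale X → ∃ (F : ℂ → ℂ) (D : Set ℂ),
      DifferentiableOn ℂ F D ∧ (∀ t ∈ Ioc (0 : ℝ) γ, closedBall (t : ℂ) (c * t) ⊆ D) ∧
      (∀ t ∈ Ioc (0 : ℝ) γ, ∀ z ∈ closedBall (t : ℂ) (c * t), ‖F z‖ ≤ M * μ ^ (C.scale X - 1 - i) * t ^ p * Real.exp (-(κ * C.d X))) ∧
      (∀ t ∈ Ioc (0 : ℝ) γ, F t = (E (Function.update g i t) U X : ℂ)))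
    (hC₀ : 0 < C₀) (hθ : 0 < θ) (hM : 0 < M) (hθμ : θ ≤ μ) (hc : 0 < c) (hp : 2 ≤ p) (hγ : 0 < γ) :
    CoordLipschitzOn (Ioc (0 : ℝ) γ) E κ
      (fun k i => 32 * (p : ℝ) ^ 2 / (min c 1 / 2) * (C₀ ^ (1 - (p : ℝ)⁻¹) * (2 * M) ^ (p : ℝ)⁻¹) / (θ ^ (1 - (p : ℝ)⁻¹) * μ ^ (p : ℝ)⁻¹)
        * (θ ^ (1 - (p : ℝ)⁻¹) * μ ^ (p : ℝ)⁻¹) ^ (k - i)) := by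
  intro U X g hg i hi s₁ hs₁ s₂ hs₂
  set s : ℝ := (p : ℝ)⁻¹ with hs
  set a : ℕ := C.scale X - 1 - i with ha
  set w : ℝ := Real.exp (-(κ * C.d X)) with hw
  have hw0 : 0 < w := Real.exp_pos _
  have hμ : 0 < μ := hθ.trans_le hθμ
  set τ : ℝ := θ ^ (1 - s) * μ ^ s with hτ
  have hτ0 : 0 < τ := mul_pos (Real.rpow_pos_of_pos hθ _) (Real.rpow_pos_of_pos hμ _)
  set c' : ℝ := min c 1 / 2 with hc'
  have hc'0 : 0 < c' := by rw [hc']; positivity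
  have hc'1 : c' ≤ 1 / 2 := by have := min_le_right c 1; rw [hc']; linarith
  set K : ℝ := 32 * (p : ℝ) ^ 2 / c' * (C₀ ^ (1 - s) * (2 * M) ^ s) with hKdef
  obtain ⟨F, D, hF, hD, hFB, hf⟩ := hA g hg U X i hi
  set f : ℝ → ℝ := fun t => E (Function.update g i t) U X with hfdef
  have hflat : ∀ x ∈ Ioc (0 : ℝ) γ, ∀ y ∈ Ioc (0 : ℝ) γ, |f x - f y| ≤ C₀ * θ ^ a * w := by
    intro x hx y hy
    have hagree : ∀ n, i + 1 ≤ n → Function.update g i x n = Function.update g i y n := fun n hn => by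
      have hni : n ≠ i := by omega
      rw [Function.update_of_ne hni, Function.update_of_ne hni]
    have h := hO _ (update_mem_boxWindow hg i hx) _ (update_mem_boxWindow hg i hy) U X (i + 1) (by omega) hagree
    rwa [show C.scale X - (i + 1) = a by omega] at h
  -- the pointwise derivative bound `K·τ^{a}·w`, UNIFORM on the window
  have hderiv : ∀ t ∈ Ioc (0 : ℝ) γ, ‖deriv F t‖ ≤ K * τ ^ a * w := by
    intro t ht
    have hflat1 : ∀ σ : ℝ, (σ = 1 ∨ σ = -1) → (∀ u : ℝ, 0 ≤ u → u ≤ c' * t → t + σ * u ∈ Ioc (0 : ℝ) γ) →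
        ∀ u : ℝ, 0 ≤ u → u ≤ min c 1 / 2 * t → ‖F ((t + σ * u : ℝ) : ℂ) - F t‖ ≤ C₀ * θ ^ a * w := by
      intro σ _ hmem u hu0 hur
      have hm := hmem u hu0 hur
      rw [hf _ hm, hf _ ht, ← Complex.ofReal_sub, Complex.norm_real, Real.norm_eq_abs]
      exact hflat _ hm _ ht
    have key : ∀ σ : ℝ, (σ = 1 ∨ σ = -1) → (∀ u : ℝ, 0 ≤ u → u ≤ c' * t → t + σ * u ∈ Ioc (0 : ℝ) γ) →
        ‖deriv F t‖ ≤ K * τ ^ a * w := by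
      intro σ hσ hmem
      have h := deriv_bound_vertex (a := a) hσ ht.1 hc hp hC₀ hθ hM hμ hw0 hF (hD t ht) (hFB t ht) (hflat1 σ hσ hmem)
      have e : 32 * (p : ℝ) ^ 2 / (min c 1 / 2) * (C₀ ^ (1 - (p : ℝ)⁻¹) * (2 * M) ^ (p : ℝ)⁻¹)
          * (θ ^ (1 - (p : ℝ)⁻¹) * μ ^ (p : ℝ)⁻¹) ^ a * w = K * τ ^ a * w := by
        rw [hKdef, hτ, hs, hc']
      exact h.trans_eq e
    by_cases htr : t + c' * t ≤ γ
    · exact key 1 (Or.inl rfl) fun u hu0 hur => ⟨by linarith [ht.1], by linarith⟩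
    · have htr : γ < t + c' * t := not_le.mp htr
      refine key (-1) (Or.inr rfl) fun u hu0 hur => ⟨?_, by linarith [ht.2]⟩
      have : c' * t ≤ t / 2 := by nlinarith [ht.1]
      linarith [ht.1]
  -- mean value on the window (§1 lemma)
  have hDn : ∀ t ∈ Ioc (0 : ℝ) γ, D ∈ 𝓝 (t : ℂ) := fun t ht =>
    mem_nhds_iff.mpr ⟨ball (t : ℂ) (c * t), ball_subset_closedBall.trans (hD t ht), isOpen_ball, mem_ball_self (mul_pos hc ht.1)⟩
  have hmain : |f s₁ - f s₂| ≤ K * τ ^ a * w * |s₁ - s₂| := abs_sub_le_of_deriv_bound hF hDn hf hderiv hs₁ hs₂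
  have hscale : C.scale X - i = a + 1 := by omega
  show |f s₁ - f s₂| ≤ w * (K / τ * τ ^ (C.scale X - i) * |s₁ - s₂|)
  rw [hscale, pow_succ]
  calc |f s₁ - f s₂| ≤ K * τ ^ a * w * |s₁ - s₂| := hmain
    _ = w * (K / τ * (τ ^ a * τ) * |s₁ - s₂|) := by field_simp

/-- **ROAD 3 AT THE VERTEX — NODE N22 FROM (P) + (O) + POWER-WEIGHTED RELATIVE-DISC ANALYTICITY.**  (P) prefix dependence; (O) oscillation
fading with constant `C₀ > 0` at the tower rate `θ > 0` (= node N18); (A_p) the young-coupling sections are analytic on the relative discs `D̄(t, ct)`,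
`t ∈ ]0, γ]`, with bounds `M·μ^{age−1}·t^{p}·e^{−κd(X)}` — vanishing to order `p ≥ 2` at the vertex, growing at ANY geometric rate `μ ≥ θ` in the
age.  Then **`NE9 E (Window γ) κ Λ ∧ FadingMemory C₉ τ_p Λ`** with `τ_p = θ^{1−1∕p}μ^{1∕p}`, `Λ k i = C₉·τ_p^{k−i}`,
`C₉ = (32p²∕c′)·C₀^{1−1∕p}(2M)^{1∕p}∕τ_p`, `c′ = min(c,1)∕2` — node N22's statement of record BY NAME; fading iff `θ^{p−1}μ < 1`. [folklore] -/
theorem ne9_and_fadingMemory_of_osc_analyticRelPow {γ κ C₀ θ M μ c : ℝ} {p : ℕ} (hP : PrefixDependenceOn E (Window γ))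
    (hO : ∀ g ∈ Window γ, ∀ g' ∈ Window γ, ∀ (U : Bg) (X : C.Dom) (a : ℕ), a ≤ C.scale X →
      (∀ n, a ≤ n → g n = g' n) → |E g U X - E g' U X| ≤ C₀ * θ ^ (C.scale X - a) * Real.exp (-(κ * C.d X)))
    (hA : ∀ g ∈ Window γ, ∀ (U : Bg) (X : C.Dom) (i : ℕ), i < C.scale X → ∃ (F : ℂ → ℂ) (D : Set ℂ),
      DifferentiableOn ℂ F D ∧ (∀ t ∈ Ioc (0 : ℝ) γ, closedBall (t : ℂ) (c * t) ⊆ D) ∧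
      (∀ t ∈ Ioc (0 : ℝ) γ, ∀ z ∈ closedBall (t : ℂ) (c * t), ‖F z‖ ≤ M * μ ^ (C.scale X - 1 - i) * t ^ p * Real.exp (-(κ * C.d X))) ∧
      (∀ t ∈ Ioc (0 : ℝ) γ, F t = (E (Function.update g i t) U X : ℂ)))
    (hC₀ : 0 < C₀) (hθ : 0 < θ) (hM : 0 < M) (hθμ : θ ≤ μ) (hc : 0 < c) (hp : 2 ≤ p) (hγ : 0 < γ) :
    NE9 E (Window γ) κ
        (fun k i => 32 * (p : ℝ) ^ 2 / (min c 1 / 2) * (C₀ ^ (1 - (p : ℝ)⁻¹) * (2 * M) ^ (p : ℝ)⁻¹) / (θ ^ (1 - (p : ℝ)⁻¹) * μ ^ (p : ℝ)⁻¹)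
          * (θ ^ (1 - (p : ℝ)⁻¹) * μ ^ (p : ℝ)⁻¹) ^ (k - i)) ∧
      FadingMemory (32 * (p : ℝ) ^ 2 / (min c 1 / 2) * (C₀ ^ (1 - (p : ℝ)⁻¹) * (2 * M) ^ (p : ℝ)⁻¹) / (θ ^ (1 - (p : ℝ)⁻¹) * μ ^ (p : ℝ)⁻¹))
        (θ ^ (1 - (p : ℝ)⁻¹) * μ ^ (p : ℝ)⁻¹)
        (fun k i => 32 * (p : ℝ) ^ 2 / (min c 1 / 2) * (C₀ ^ (1 - (p : ℝ)⁻¹) * (2 * M) ^ (p : ℝ)⁻¹) / (θ ^ (1 - (p : ℝ)⁻¹) * μ ^ (p : ℝ)⁻¹)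
          * (θ ^ (1 - (p : ℝ)⁻¹) * μ ^ (p : ℝ)⁻¹) ^ (k - i)) := by
  have hμ : 0 < μ := hθ.trans_le hθμ
  have hτ0 : 0 < θ ^ (1 - (p : ℝ)⁻¹) * μ ^ (p : ℝ)⁻¹ := mul_pos (Real.rpow_pos_of_pos hθ _) (Real.rpow_pos_of_pos hμ _)
  have hC₉ : 0 ≤ 32 * (p : ℝ) ^ 2 / (min c 1 / 2) * (C₀ ^ (1 - (p : ℝ)⁻¹) * (2 * M) ^ (p : ℝ)⁻¹) / (θ ^ (1 - (p : ℝ)⁻¹) * μ ^ (p : ℝ)⁻¹) := by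
    have h1 : 0 ≤ C₀ ^ (1 - (p : ℝ)⁻¹) := Real.rpow_nonneg hC₀.le _
    have h2 : 0 ≤ (2 * M) ^ (p : ℝ)⁻¹ := Real.rpow_nonneg (by linarith) _
    have h3 : 0 < min c 1 / 2 := by positivity
    positivity
  exact ⟨ne9_of_coordLipschitz hP (coordLipschitzOn_of_osc_analyticRelPow hO hA hC₀ hθ hM hθμ hc hp hγ),
    fadingMemory_geometric hC₉ hτ0.le⟩

end Abstract

/-! ## §3 At the record (plan word (W2)): the vertex slot carries `N22At`; `S_N22` for every `RRec` carrying it -/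

section AtRecord

open Literature.MathematicalPhysics.QuantumFieldTheory.Balaban1983to89
open Literature.MathematicalPhysics.QuantumFieldTheory.Balaban1983to89.T4Continuum
open Literature.MathematicalPhysics.QuantumFieldTheory.Balaban1983to89.T4OutputRate
open YMDAG.UVSplit

/-- **THE VERTEX SLOT CARRIES `N22At`** (companion of `YMDAG.N22.n22At_of_oscAnalytic`): a U3 bundle with window `Window γ`, (P), (O) at the
bundle's rate `θ > 0`, (A_p) power-weighted relative-disc analyticity (`c > 0`, `p ≥ 2`, bounds `M·μ^{age−1}·t^{p}·e^{−κd}`, `θ ≤ μ`) and letters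
`ω = θ^{1−1∕p}μ^{1∕p}`, `Λ k i = C₉·ω^{k−i}`, `C₉ = (32p²∕c′)·C₀^{1−1∕p}(2M)^{1∕p}∕ω` carries `N22At`. [folklore] -/
theorem n22At_of_oscAnalyticRelPow (u : U3Carriers) {C₀ M μ c : ℝ} {p : ℕ} (hW : u.W = Window u.γ)
    (hP : PrefixDependenceOn u.EA (Window u.γ))
    (hO : ∀ g ∈ Window u.γ, ∀ g' ∈ Window u.γ, ∀ (U : u.C.BgA) (X : u.C.Dom) (a : ℕ), a ≤ u.C.scale X →
      (∀ n, a ≤ n → g n = g' n) → |u.EA g U X - u.EA g' U X| ≤ C₀ * u.θ ^ (u.C.scale X - a) * Real.exp (-(u.κ * u.C.d X)))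
    (hA : ∀ g ∈ Window u.γ, ∀ (U : u.C.BgA) (X : u.C.Dom) (i : ℕ), i < u.C.scale X → ∃ (F : ℂ → ℂ) (Dset : Set ℂ),
      DifferentiableOn ℂ F Dset ∧ (∀ t ∈ Ioc (0 : ℝ) u.γ, closedBall (t : ℂ) (c * t) ⊆ Dset) ∧
      (∀ t ∈ Ioc (0 : ℝ) u.γ, ∀ z ∈ closedBall (t : ℂ) (c * t),
        ‖F z‖ ≤ M * μ ^ (u.C.scale X - 1 - i) * t ^ p * Real.exp (-(u.κ * u.C.d X))) ∧
      (∀ t ∈ Ioc (0 : ℝ) u.γ, F t = (u.EA (Function.update g i t) U X : ℂ)))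
    (hC₀ : 0 < C₀) (hθ : 0 < u.θ) (hM : 0 < M) (hθμ : u.θ ≤ μ) (hc : 0 < c) (hp : 2 ≤ p) (hγ : 0 < u.γ)
    (hω : u.ω = u.θ ^ (1 - (p : ℝ)⁻¹) * μ ^ (p : ℝ)⁻¹) (hΛ : u.Λ = fun k i => u.C₉ * u.ω ^ (k - i))
    (hC₉ : u.C₉ = 32 * (p : ℝ) ^ 2 / (min c 1 / 2) * (C₀ ^ (1 - (p : ℝ)⁻¹) * (2 * M) ^ (p : ℝ)⁻¹) / (u.θ ^ (1 - (p : ℝ)⁻¹) * μ ^ (p : ℝ)⁻¹)) :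
    N22At u := by
  show NE9 u.EA u.W u.κ u.Λ ∧ FadingMemory u.C₉ u.ω u.Λ
  rw [hW, hΛ, hC₉, hω]
  exact ne9_and_fadingMemory_of_osc_analyticRelPow hP hO hA hC₀ hθ hM hθμ hc hp hγ

/-- **`S_N22 RRec` FOR EVERY `RRec` WHOSE BUNDLES CARRY THE VERTEX SLOT** (refinement-generic; combine with `YMDAG.N22.s_N22_of_refines`). [folklore] -/
theorem s_N22_of_oscAnalyticRelPow {N : ℕ} [NeZero N] (RRec : RateRecordPred N)
    (hslot : ∀ (F : T4Family) (D : Datum F N) (g₀ : ℕ → ℝ) (os : List (ULoop F)) (R : RateCarriers N), RRec F D g₀ os R →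
      ∃ (C₀ M μ c : ℝ) (p : ℕ), R.u3.W = Window R.u3.γ ∧ PrefixDependenceOn R.u3.EA (Window R.u3.γ) ∧
        (∀ g ∈ Window R.u3.γ, ∀ g' ∈ Window R.u3.γ, ∀ (U : R.u3.C.BgA) (X : R.u3.C.Dom) (a : ℕ), a ≤ R.u3.C.scale X →
          (∀ n, a ≤ n → g n = g' n) →
            |R.u3.EA g U X - R.u3.EA g' U X| ≤ C₀ * R.u3.θ ^ (R.u3.C.scale X - a) * Real.exp (-(R.u3.κ * R.u3.C.d X))) ∧
        (∀ g ∈ Window R.u3.γ, ∀ (U : R.u3.C.BgA) (X : R.u3.C.Dom) (i : ℕ), i < R.u3.C.scale X → ∃ (Fz : ℂ → ℂ) (Dset : Set ℂ),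
          DifferentiableOn ℂ Fz Dset ∧ (∀ t ∈ Ioc (0 : ℝ) R.u3.γ, closedBall (t : ℂ) (c * t) ⊆ Dset) ∧
          (∀ t ∈ Ioc (0 : ℝ) R.u3.γ, ∀ z ∈ closedBall (t : ℂ) (c * t),
            ‖Fz z‖ ≤ M * μ ^ (R.u3.C.scale X - 1 - i) * t ^ p * Real.exp (-(R.u3.κ * R.u3.C.d X))) ∧
          (∀ t ∈ Ioc (0 : ℝ) R.u3.γ, Fz t = (R.u3.EA (Function.update g i t) U X : ℂ))) ∧
        0 < C₀ ∧ 0 < R.u3.θ ∧ 0 < M ∧ R.u3.θ ≤ μ ∧ 0 < c ∧ 2 ≤ p ∧ 0 < R.u3.γ ∧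
        R.u3.ω = R.u3.θ ^ (1 - (p : ℝ)⁻¹) * μ ^ (p : ℝ)⁻¹ ∧ (R.u3.Λ = fun k i => R.u3.C₉ * R.u3.ω ^ (k - i)) ∧
        R.u3.C₉ = 32 * (p : ℝ) ^ 2 / (min c 1 / 2) * (C₀ ^ (1 - (p : ℝ)⁻¹) * (2 * M) ^ (p : ℝ)⁻¹) /
          (R.u3.θ ^ (1 - (p : ℝ)⁻¹) * μ ^ (p : ℝ)⁻¹)) :
    S_N22 RRec := by
  intro F D g₀ os R hR
  obtain ⟨C₀, M, μ, c, p, hW, hP, hO, hA, hC₀, hθ, hM, hθμ, hc, hp, hγ, hω, hΛ, hC₉⟩ := hslot F D g₀ os R hR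
  exact n22At_of_oscAnalyticRelPow R.u3 hW hP hO hA hC₀ hθ hM hθμ hc hp hγ hω hΛ hC₉

end AtRecord

/-! ## §4 The vertex difference-quotient letter: Cauchy alone gives the rate `θ` -/

section Quotient

open Literature.MathematicalPhysics.QuantumFieldTheory.Balaban1983to89
open Literature.MathematicalPhysics.QuantumFieldTheory.Balaban1983to89.T4OutputRate
open Literature.MathematicalPhysics.QuantumFieldTheory.Balaban1983to89.T4CouplingAnalyticity
  (CoordLipschitzOn update_mem_boxWindow ne9_of_coordLipschitz)
open Summit.QuantumFields.YangMills.BalabanUVNodes.N22Knit (fadingMemory_geometric)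

variable {C : Carriers} {Bg : Type} {E : Functional C Bg}

/-- **THE VERTEX DIFFERENCE-QUOTIENT LETTER ⇒ NE9 ∧ FADING MEMORY AT THE RATE `θ`, BY CAUCHY ALONE.**  If every young-coupling section extends
to `F` analytic on a set containing the relative discs `D̄(t, ct)`, `t ∈ ]0, γ]`, with a vertex value `e₀` and
`‖F(z) − e₀‖ ≤ K·θ^{scale X − 1 − i}·‖z‖·e^{−κd(X)}` on those discs (UV-insensitivity of the DIFFERENCE QUOTIENT from the vertex — fading
memory stated at the derivative level, i.e. W1's content read at `g_i = 0`), then with (P): **`NE9 E (Window γ) κ Λ ∧ FadingMemory C₉ θ Λ`**,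
`Λ k i = C₉·θ^{k−i}`, `C₉ = K(1+c)∕(cθ)` — no oscillation hypothesis and no interpolation needed.  Recorded to make the census's third vertex
option a kernel statement; it is the located form of what (2.9)'s relative radii require for fading. [folklore] -/
theorem ne9_and_fadingMemory_of_vertexQuotient {γ κ K θ c : ℝ} (hP : PrefixDependenceOn E (Window γ))
    (hA : ∀ g ∈ Window γ, ∀ (U : Bg) (X : C.Dom) (i : ℕ), i < C.scale X → ∃ (F : ℂ → ℂ) (D : Set ℂ) (e₀ : ℂ),
      DifferentiableOn ℂ F D ∧ (∀ t ∈ Ioc (0 : ℝ) γ, closedBall (t : ℂ) (c * t) ⊆ D) ∧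
      (∀ t ∈ Ioc (0 : ℝ) γ, ∀ z ∈ closedBall (t : ℂ) (c * t), ‖F z - e₀‖ ≤ K * θ ^ (C.scale X - 1 - i) * ‖z‖ * Real.exp (-(κ * C.d X))) ∧
      (∀ t ∈ Ioc (0 : ℝ) γ, F t = (E (Function.update g i t) U X : ℂ)))
    (hK : 0 ≤ K) (hθ : 0 < θ) (hc : 0 < c) :
    NE9 E (Window γ) κ (fun k i => K * (1 + c) / (c * θ) * θ ^ (k - i)) ∧
      FadingMemory (K * (1 + c) / (c * θ)) θ (fun k i => K * (1 + c) / (c * θ) * θ ^ (k - i)) := by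
  have hC₉ : 0 ≤ K * (1 + c) / (c * θ) := by positivity
  refine ⟨ne9_of_coordLipschitz (I := Ioc (0 : ℝ) γ) hP ?_, fadingMemory_geometric hC₉ hθ.le⟩
  intro U X g hg i hi s₁ hs₁ s₂ hs₂
  set a : ℕ := C.scale X - 1 - i with ha
  set w : ℝ := Real.exp (-(κ * C.d X)) with hw
  have hw0 : 0 < w := Real.exp_pos _
  obtain ⟨F, D, e₀, hF, hD, hFB, hf⟩ := hA g hg U X i hi
  set f : ℝ → ℝ := fun t => E (Function.update g i t) U X with hfdef
  -- Cauchy on the circle of radius `ct` for `F − e₀`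
  have hderiv : ∀ t ∈ Ioc (0 : ℝ) γ, ‖deriv F t‖ ≤ K * (1 + c) / c * θ ^ a * w := by
    intro t ht
    have hct : 0 < c * t := mul_pos hc ht.1
    have hd : deriv (fun z => F z - e₀) (t : ℂ) = deriv F t := deriv_sub_const e₀
    -- on the sphere `‖z‖ ≤ t + ct = (1 + c)t`
    have hsup : ∀ z ∈ sphere (t : ℂ) (c * t), K * θ ^ a * ‖z‖ * w ≤ K * θ ^ a * ((1 + c) * t) * w := by
      intro z hz
      have hz' : ‖z‖ ≤ (1 + c) * t := by
        rw [mem_sphere, dist_eq_norm] at hz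
        calc ‖z‖ ≤ ‖z - (t : ℂ)‖ + ‖((t : ℝ) : ℂ)‖ := norm_le_norm_sub_add _ _
          _ = c * t + t := by rw [hz, Complex.norm_real, Real.norm_of_nonneg ht.1.le]
          _ = (1 + c) * t := by ring
      have : 0 ≤ K * θ ^ a := mul_nonneg hK (pow_nonneg hθ.le a)
      nlinarith [mul_nonneg this hw0.le]
    have hC' := Complex.norm_deriv_le_of_forall_mem_sphere_norm_le hct ((hF.sub_const e₀).diffContOnCl_ball (hD t ht))
      (fun z hz => (hFB t ht z (sphere_subset_closedBall hz)).trans (hsup z hz))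
    rw [hd] at hC'
    calc ‖deriv F t‖ ≤ K * θ ^ a * ((1 + c) * t) * w / (c * t) := hC'
      _ = K * (1 + c) / c * θ ^ a * w := by
          rw [div_eq_iff hct.ne']
          field_simp
  have hDn : ∀ t ∈ Ioc (0 : ℝ) γ, D ∈ 𝓝 (t : ℂ) := fun t ht =>
    mem_nhds_iff.mpr ⟨ball (t : ℂ) (c * t), ball_subset_closedBall.trans (hD t ht), isOpen_ball, mem_ball_self (mul_pos hc ht.1)⟩
  have hmain : |f s₁ - f s₂| ≤ K * (1 + c) / c * θ ^ a * w * |s₁ - s₂| := abs_sub_le_of_deriv_bound hF hDn hf hderiv hs₁ hs₂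
  have hscale : C.scale X - i = a + 1 := by omega
  show |f s₁ - f s₂| ≤ w * (K * (1 + c) / (c * θ) * θ ^ (C.scale X - i) * |s₁ - s₂|)
  rw [hscale, pow_succ]
  calc |f s₁ - f s₂| ≤ K * (1 + c) / c * θ ^ a * w * |s₁ - s₂| := hmain
    _ = w * (K * (1 + c) / (c * θ) * (θ ^ a * θ) * |s₁ - s₂|) := by field_simp

end Quotient

end Summit.QuantumFields.YangMills.BalabanUVNodes.N22KnitVertex

end
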